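import Mathlib
import Summits.Ventures.PercRepro2.Graph
import Summits.Ventures.PercRepro2.Exploration
import Summits.Ventures.PercRepro2.Harris
import Summits.Ventures.PercRepro2.GibbsPAJoint
import Summits.Ventures.PercRepro2.SepClusterJoint

/-!
# The separated cluster — positivity, the support, and the conditional expectations (blind cell
PercRepro2, p3 g12, 2026-08-27; `proofs/P3-G2.md` §2, Lemma 4, single-root form)

Part 2 of the formalisation of Theorem A of `P3-G2.md`.  With every edge weight strictly inside
`(0, 1)` every configuration has positive weight (`weight_pos`), so a set is in the support of a
marginal of the joint law iff it is the explored cluster of some separated configuration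
(`sum_J_right_ne_zero`, `exists_mem_of_sum_J_right_ne_zero`, …), and the cluster explored away
from a supported cluster of the other root is again in the support (`clAway_mem_support_right`,
`clAway_mem_support_left`).  The two conditional expectations of the Gibbs sampler are
expectations of the other root's cluster explored away from the conditioning cluster
(`condS_eq_expect`, `condS_transpose_eq_expect`) — Lemma 4 (i) of the paper.  Own work; standard
axioms.
-/

namespace Summit.Ventures.PercRepro2

namespace SepPA

open Finset Classical

section Separated

variable {V : Type*} {E : Type*} [Fintype V] [Fintype E] [DecidableEq E]
variable (ends : E → Sym2 V) (p : E → ℝ) (x y : V)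

omit [Fintype V] [DecidableEq E] in
/-- Every configuration has positive weight when all edge weights lie strictly inside `(0,1)`. -/
lemma weight_pos (hp01 : ∀ e, 0 < p e ∧ p e < 1) (ω : Config E) : 0 < weight p ω := by
  unfold weight
  apply Finset.prod_pos
  intro e _
  unfold edgeFactor
  cases ω e
  · simp only [Bool.false_eq_true, ↓reduceIte]; linarith [(hp01 e).2]
  · simp only [↓reduceIte]; exact (hp01 e).1

omit [Fintype V] [Fintype E] [DecidableEq E] in
/-- Strictly interior weights are admissible. -/
lemma isProbVec_of_interior (hp01 : ∀ e, 0 < p e ∧ p e < 1) : IsProbVec p :=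
  ⟨fun e => le_of_lt (hp01 e).1, fun e => le_of_lt (hp01 e).2⟩

omit [Fintype V] in
/-- A non-empty event has positive probability (interior weights). -/
lemma prob_pos_of_mem (hp01 : ∀ e, 0 < p e ∧ p e < 1) {A : Set (Config E)} {ω : Config E}
    (hω : ω ∈ A) : 0 < prob p A := by
  unfold prob
  have h1 : A.indicator (weight p) ω ≤ ∑ ω', A.indicator (weight p) ω' :=
    Finset.single_le_sum (fun ω' _ => Set.indicator_nonneg
      (fun ω'' _ => weight_nonneg (isProbVec_of_interior p hp01) ω'') ω') (Finset.mem_univ ω)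
  rw [Set.indicator_of_mem hω] at h1
  exact lt_of_lt_of_le (weight_pos p hp01 ω) h1

omit [Fintype V] in
/-- The empty event has probability `0`. -/
lemma prob_empty : prob p (∅ : Set (Config E)) = 0 := by
  unfold prob
  simp

variable {x y}

omit [Fintype V] [Fintype E] [DecidableEq E] in
/-- The separation event contains the all-closed configuration. -/
lemma allFalse_mem_sepEvent (hxy : x ≠ y) : (fun _ => false : Config E) ∈ sepEvent ends x y := by
  intro h
  have hc : cluster ends (fun _ => false) x = {x} :=
    cluster_eq_singleton_of_closed (fun e _ => rfl)
  have : y ∈ cluster ends (fun _ => false) x := h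
  rw [hc, Set.mem_singleton_iff] at this
  exact hxy this.symm

omit [Fintype V] in
/-- `P(x ↮ y) > 0` for `x ≠ y` (interior weights). -/
lemma prob_sepEvent_pos (hp01 : ∀ e, 0 < p e ∧ p e < 1) (hxy : x ≠ y) :
    0 < prob p (sepEvent ends x y) :=
  prob_pos_of_mem p hp01 (allFalse_mem_sepEvent ends hxy)

/-- A configuration in `{C(y) = D} ∩ {x ↮ y}` puts `D` in the support of the `y`-marginal. -/
lemma sum_J_right_ne_zero (hp01 : ∀ e, 0 < p e ∧ p e < 1) (hxy : x ≠ y) {D : Set V}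
    {ω : Config E} (hω : ω ∈ clusterEvent ends y D ∩ sepEvent ends x y) :
    (∑ K, J ends p x y D K) ≠ 0 := by
  rw [sum_J_right]
  exact div_ne_zero (ne_of_gt (prob_pos_of_mem p hp01 hω))
    (ne_of_gt (prob_sepEvent_pos ends p hp01 hxy))

/-- A configuration in `{C(x) = K} ∩ {x ↮ y}` puts `K` in the support of the `x`-marginal. -/
lemma sum_J_left_ne_zero (hp01 : ∀ e, 0 < p e ∧ p e < 1) (hxy : x ≠ y) {K : Set V}
    {ω : Config E} (hω : ω ∈ clusterEvent ends x K ∩ sepEvent ends x y) :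
    (∑ D, J ends p x y D K) ≠ 0 := by
  rw [sum_J_left]
  exact div_ne_zero (ne_of_gt (prob_pos_of_mem p hp01 hω))
    (ne_of_gt (prob_sepEvent_pos ends p hp01 hxy))

/-- A set in the support of the `y`-marginal is the cluster of `y` of some separated
configuration. -/
lemma exists_mem_of_sum_J_right_ne_zero {D : Set V} (hD : (∑ K, J ends p x y D K) ≠ 0) :
    ∃ ω, ω ∈ clusterEvent ends y D ∩ sepEvent ends x y := by
  by_contra h
  apply hD
  rw [sum_J_right]
  have : clusterEvent ends y D ∩ sepEvent ends x y = ∅ := by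
    ext ω
    simp only [Set.mem_empty_iff_false, iff_false]
    exact fun hω => h ⟨ω, hω⟩
  rw [this, prob_empty, zero_div]

/-- A set in the support of the `x`-marginal is the cluster of `x` of some separated
configuration. -/
lemma exists_mem_of_sum_J_left_ne_zero {K : Set V} (hK : (∑ D, J ends p x y D K) ≠ 0) :
    ∃ ω, ω ∈ clusterEvent ends x K ∩ sepEvent ends x y := by
  by_contra h
  apply hK
  rw [sum_J_left]
  have : clusterEvent ends x K ∩ sepEvent ends x y = ∅ := by
    ext ω
    simp only [Set.mem_empty_iff_false, iff_false]
    exact fun hω => h ⟨ω, hω⟩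
  rw [this, prob_empty, zero_div]

omit [Fintype V] [Fintype E] [DecidableEq E] in
/-- In the graph with the edges touching `K ∋ x` removed, `x` is isolated. -/
lemma clAway_self_eq_singleton {K : Set V} (hx : x ∈ K) (ω : Config E) :
    cluster ends (restrict (touches ends K)ᶜ ω) x = {x} := by
  apply cluster_eq_singleton_of_closed
  intro e he
  obtain ⟨a, ha, b, hab⟩ := he
  rw [Set.mem_singleton_iff] at ha
  have : e ∈ touches ends K := ⟨a, ha ▸ hx, b, hab⟩
  exact restrict_apply_of_notMem (by simpa using this)

omit [Fintype V] [Fintype E] [DecidableEq E] in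
/-- The configuration restricted away from `K ∋ x` is separated. -/
lemma restrict_mem_sepEvent (hxy : x ≠ y) {K : Set V} (hx : x ∈ K) (ω : Config E) :
    restrict (touches ends K)ᶜ ω ∈ sepEvent ends x y := by
  intro h
  have : y ∈ cluster ends (restrict (touches ends K)ᶜ ω) x := h
  rw [clAway_self_eq_singleton ends hx ω, Set.mem_singleton_iff] at this
  exact hxy this.symm

/-- The `y`-cluster explored away from a supported `x`-cluster is in the support. -/
lemma clAway_mem_support_right (hp01 : ∀ e, 0 < p e ∧ p e < 1) (hxy : x ≠ y) {K : Set V}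
    (hK : (∑ D, J ends p x y D K) ≠ 0) (ω : Config E) :
    (∑ K', J ends p x y (clAway ends K y ω) K') ≠ 0 := by
  obtain ⟨ω₀, hω₀⟩ := exists_mem_of_sum_J_left_ne_zero ends p hK
  have hx : x ∈ K := by
    have := mem_cluster_self ends ω₀ x
    rwa [hω₀.1] at this
  apply sum_J_right_ne_zero ends p hp01 hxy (ω := restrict (touches ends K)ᶜ ω)
  exact ⟨rfl, restrict_mem_sepEvent ends hxy hx ω⟩

/-- The `x`-cluster explored away from a supported `y`-cluster is in the support. -/
lemma clAway_mem_support_left (hp01 : ∀ e, 0 < p e ∧ p e < 1) (hxy : x ≠ y) {D : Set V}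
    (hD : (∑ K, J ends p x y D K) ≠ 0) (ω : Config E) :
    (∑ D', J ends p x y D' (clAway ends D x ω)) ≠ 0 := by
  obtain ⟨ω₀, hω₀⟩ := exists_mem_of_sum_J_right_ne_zero ends p hD
  have hy : y ∈ D := by
    have := mem_cluster_self ends ω₀ y
    rwa [hω₀.1] at this
  apply sum_J_left_ne_zero ends p hp01 hxy (ω := restrict (touches ends D)ᶜ ω)
  refine ⟨rfl, ?_⟩
  -- `y` is isolated in the restricted configuration, hence separated from `x`
  intro h
  have hc : cluster ends (restrict (touches ends D)ᶜ ω) y = {y} :=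
    clAway_self_eq_singleton ends hy ω
  have : x ∈ cluster ends (restrict (touches ends D)ᶜ ω) y := conn_symm h
  rw [hc, Set.mem_singleton_iff] at this
  exact hxy this

/-- The pushforward identity for a function of an explored cluster. -/
lemma expect_comp_eq_sum (c : Config E → Set V) (g : Set V → ℝ) :
    expect p (fun ω => g (c ω)) = ∑ D, prob p {ω | c ω = D} * g D := by
  have h := expect_indicator_comp_eq_sum p Set.univ c g
  simp only [Set.indicator_univ, one_mul, Set.univ_inter] at h
  exact h

/-- The conditional expectation given a supported `x`-cluster `K` is the expectation of `g` of the
`y`-cluster explored away from `K`. -/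
theorem condS_eq_expect (hp01 : ∀ e, 0 < p e ∧ p e < 1) (hxy : x ≠ y) (g : Set V → ℝ)
    {K : Set V} (hK : (∑ D, J ends p x y D K) ≠ 0) :
    GibbsPAJoint.condS (J ends p x y) g K = expect p (fun ω => g (clAway ends K y ω)) := by
  obtain ⟨ω₀, hω₀⟩ := exists_mem_of_sum_J_left_ne_zero ends p hK
  have hy : y ∉ K := not_mem_of_mem_sepEvent' hω₀.1 hω₀.2
  have hsub : clusterEvent ends x K ∩ sepEvent ends x y = clusterEvent ends x K := by
    apply Set.inter_eq_left.mpr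
    intro ω hω
    exact mem_sepEvent_of_cluster_eq' hω hy
  have hpos : prob p (clusterEvent ends x K) ≠ 0 := by
    rw [← hsub]
    exact ne_of_gt (prob_pos_of_mem p hp01 hω₀)
  have hS : prob p (sepEvent ends x y) ≠ 0 := ne_of_gt (prob_sepEvent_pos ends p hp01 hxy)
  unfold GibbsPAJoint.condS
  rw [sum_J_left, hsub, expect_comp_eq_sum]
  have hJ : ∀ D, J ends p x y D K * g D =
      (prob p (clusterEvent ends x K) / prob p (sepEvent ends x y)) *
        (prob p {ω | clAway ends K y ω = D} * g D) := by
    intro D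
    unfold J
    rw [prob_joint_eq' ends p x y hy D]
    ring
  simp_rw [hJ]
  rw [← Finset.mul_sum]
  field_simp

/-- The conditional expectation given a supported `y`-cluster `D` is the expectation of `F` of the
`x`-cluster explored away from `D`. -/
theorem condS_transpose_eq_expect (hp01 : ∀ e, 0 < p e ∧ p e < 1) (hxy : x ≠ y)
    (F : Set V → ℝ) {D : Set V} (hD : (∑ K, J ends p x y D K) ≠ 0) :
    GibbsPAJoint.condS (GibbsPAJoint.transpose (J ends p x y)) F D =
      expect p (fun ω => F (clAway ends D x ω)) := by
  obtain ⟨ω₀, hω₀⟩ := exists_mem_of_sum_J_right_ne_zero ends p hD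
  have hx : x ∉ D := not_mem_of_mem_sepEvent hω₀.1 hω₀.2
  have hsub : clusterEvent ends y D ∩ sepEvent ends x y = clusterEvent ends y D := by
    apply Set.inter_eq_left.mpr
    intro ω hω
    exact mem_sepEvent_of_cluster_eq hω hx
  have hpos : prob p (clusterEvent ends y D) ≠ 0 := by
    rw [← hsub]
    exact ne_of_gt (prob_pos_of_mem p hp01 hω₀)
  have hS : prob p (sepEvent ends x y) ≠ 0 := ne_of_gt (prob_sepEvent_pos ends p hp01 hxy)
  unfold GibbsPAJoint.condS GibbsPAJoint.transpose
  rw [sum_J_right, hsub, expect_comp_eq_sum]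
  have hJ : ∀ K, J ends p x y D K * F K =
      (prob p (clusterEvent ends y D) / prob p (sepEvent ends x y)) *
        (prob p {ω | clAway ends D x ω = K} * F K) := by
    intro K
    unfold J
    rw [prob_joint_eq ends p x y hx K]
    ring
  simp_rw [hJ]
  rw [← Finset.mul_sum]
  field_simp

end Separated

end SepPA

end Summit.Ventures.PercRepro2
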